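import Summits.QuantumFields.YangMills.Theorems.BalabanUVNodesN08AlphaB7AllScales
import Literature.MathematicalPhysics.QuantumFieldTheory.Balaban1983to89.B8Thm4TruncationLocal
import HarnessLib

/-!
# `AlphaInputsT3ACv3LiftAvgLocalCont` — STRATEGY B for 2′, RE-CUT OF THE ADAPTED CLASS, PART R0: [4] PROP. 2 WITH ITS PRINTED LOCALITY, **LOCALLY** — the lifted `j`-fold
# average at a bond is continuous AT every configuration whose lift is (68)-regular on the bond box; closed `pdevOn`-balls; bond boxes inside plaquette boxes —
# lane `pub-balaban3d`, seat alpha-2 (g3)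

WHY (HOME `D6L-STATUS-alpha2-g3.md` §4).  The read-local adapted class `𝒞_R` (sibling `…AdaptedClassR`) replaces [7]'s closed regular class `regClassC` by the half-constant form of
EXACTLY what row `h68` reads (`pdevOn` on the box under each recorded plaquette); its closedness with the (67)-largeness set needs the continuity of the lifted [4]-averages at the
four bonds of a recorded coarse plaquette from THAT box bound alone.  NODE O's `…B7AllScales.continuousOn_val_liftAvg_regClass` used `U₀ ∈ regClass` only through
`pdevOn_bondBox_lt`; ★ `continuousAt_val_liftAvg_of_pdevOn` is the same proof with the membership replaced by the box bound (clamped lift, [4] Prop. 2 `prop2_explicit` at every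
level `≤ j`, `log`-arguments `< 1`, gen 4's `continuousAt_val_avgIter_succ`, locality `avgIter_congr`).  Also: `continuous_val_hol_liftCfg`, `isClosed_pdevOn_le` (a `pdevOn`-ball
`{U | pdevOn lo hi (lift U) ≤ c}` is closed), `pdevOn_le_of_forall_ne`, `pdevOn_bondBox_le_plaqBox` (the bond boxes of the four bonds of a non-degenerate coarse plaquette lie in
its plaquette box; `B8Thm4TruncationLocal.pdevOn_mono`).
HONEST FRAMING.  Kernel continuity∕bookkeeping over [4]'s definitions and [4] Prop. 2 AS PROVED IN THE TREE; nothing of [B10]∕[7] asserted; count-neutral helper toward R3 2′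
(`stub_laneRecordsV3`, items 19935∕19936); nothing about d = 4, the continuum, or a mass gap.

References: T. Bałaban, Commun. Math. Phys. 98 (1985) 17–51 [Balaban1985Averaging] (Prop. 2 (54) p.26, p.24 locality, p.25); CMP 102 (1985) 255–275 [Balaban1985UV3] ((68) p.273).
-/

set_option autoImplicit false

noncomputable section

/-! ## §1 The lifted averages are continuous at every configuration whose lift is (68)-regular on the bond box (generic) -/

namespace Summit.QuantumFields.YangMills.Theorems.ReadLocal

open Set Topology TopologicalSpace NormedSpace
open scoped Matrix Matrix.Norms.L2Operator BigOperators
open Literature.MathematicalPhysics.QuantumFieldTheory.Balaban1983to89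
open Literature.MathematicalPhysics.QuantumFieldTheory.Balaban1983to89.B10 (pFun)
open Literature.MathematicalPhysics.QuantumFieldTheory.Balaban1985CMP102
open Literature.MathematicalPhysics.QuantumFieldTheory.Balaban1985CMP102.Setting
open Summit.QuantumFields.Balaban3D.Carriers
open Summit.QuantumFields.Balaban3D.Proofs.Primitives (AlphaConsts)
open Summit.QuantumFields.Balaban3D.Proofs.ScalesArithmetic (gk_pos gk_le_one)
open Summit.QuantumFields.Balaban3D.Proofs.LiftBridge (liftCfg liftCfg_mem_unitaryUnits)
open Summit.QuantumFields.YangMills.Theorems.BalabanUVNodesN08AlphaGroupTopology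
open Summit.QuantumFields.YangMills.Theorems.BalabanUVNodesN08AlphaLiftAvgCont (continuousAt_val_avgIter_succ)
open B7Prop1Explicit (hol plaqWord e e_apply Wcx boxVec U1)
open B7Prop1Local (InBox loK bondHiK clampCfg clampCfg_agree clampCfg_mem pdevOn pdev_clampCfg_le avgIter_congr)
open B7Prop2Explicit (avgIter avgIter_zero pdev le_pdev C0 c2' prop2_explicit unitaryUnits unitaryUnits_le_U1 avgClosed_unitaryUnits norm_Wcx_sub_one_le)
open Literature.MathematicalPhysics.QuantumFieldTheory.Balaban1983to89.B8Thm4TruncationLocal (pdevOn_mono)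

variable {L : ℕ} {S : Scales L} {G : Type} [GaugeGroup G] [MeasurableSpace G] (𝔊 : GroupModel G) (𝔠 : AlphaConsts L 𝔊.N)

/-- **★ (b7) LOCALLY: THE LIFTED `j`-FOLD [4]-AVERAGE AT `(z, κ)` IS CONTINUOUS AT EVERY `U₀` WHOSE LIFT IS (68)-REGULAR ON THE BOND BOX** — `pdevOn [loK L j z, bondHiK L j z κ]
(lift U₀) < α₀·L^{−2j}`, `α₀ = C68·g_jp(g_j)` (`j ≤ K`, `L ≥ 2`), under [4]'s window `C₀α₀ ≤ ⅓`, `2α₀ ≤ c₂′(d,L)`, `512(d+1)(d+4)L²(α₀ + 2C₀α₀²) ≤ 1`.  NODE O's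
`continuousOn_val_liftAvg_regClass` VERBATIM with the class membership replaced by the box bound it was used for. [cite: Balaban1985Averaging, Prop. 2 (54) p.26 + p.24 (locality) + p.25] -/
theorem continuousAt_val_liftAvg_of_pdevOn (hL2 : 2 ≤ L) {j : ℕ} (hj : j ≤ S.K)
    (hα3 : C0 S.P.d * (𝔠.C68 * (S.gk j * pFun 𝔠.lane.carrier.b₀ 𝔠.lane.carrier.p₀ (S.gk j))) ≤ 1 / 3)
    (hα2 : 2 * (𝔠.C68 * (S.gk j * pFun 𝔠.lane.carrier.b₀ 𝔠.lane.carrier.p₀ (S.gk j))) ≤ c2' S.P.d L)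
    (hwin : 512 * ((S.P.d : ℝ) + 1) * (S.P.d + 4) * (L : ℝ) ^ 2 *
      ((𝔠.C68 * (S.gk j * pFun 𝔠.lane.carrier.b₀ 𝔠.lane.carrier.p₀ (S.gk j))) +
        2 * C0 S.P.d * (𝔠.C68 * (S.gk j * pFun 𝔠.lane.carrier.b₀ 𝔠.lane.carrier.p₀ (S.gk j))) ^ 2) ≤ 1)
    (z : B7Prop1Explicit.Site S.P.d) (κ : Fin S.P.d) {U₀ : GaugeField S.P 0 G}
    (hU₀ : pdevOn (loK L j z) (bondHiK L j z κ) (liftCfg 𝔊 U₀) <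
      𝔠.C68 * (S.gk j * pFun 𝔠.lane.carrier.b₀ 𝔠.lane.carrier.p₀ (S.gk j)) * (((L : ℝ) ^ j)⁻¹) ^ 2) :
    letI := rhoTopology 𝔊; ContinuousAt (fun U : GaugeField S.P 0 G =>
      ((avgIter L (liftCfg 𝔊 U) j z κ : (Matrix (Fin 𝔊.N) (Fin 𝔊.N) ℂ)ˣ) : Matrix (Fin 𝔊.N) (Fin 𝔊.N) ℂ)) U₀ := by
  letI := rhoTopology 𝔊
  haveI : NeZero 𝔊.N := ⟨Nat.pos_iff_ne_zero.mp 𝔊.N_pos⟩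
  letI : CStarAlgebra (Matrix (Fin 𝔊.N) (Fin 𝔊.N) ℂ) := {}
  have hL1 : 1 ≤ L := le_trans (by norm_num) hL2
  set α₀ : ℝ := 𝔠.C68 * (S.gk j * pFun 𝔠.lane.carrier.b₀ 𝔠.lane.carrier.p₀ (S.gk j)) with hα₀
  have hαpos : 0 < α₀ := by
    have hgj : 0 < S.gk j := gk_pos S j
    exact mul_pos 𝔠.C68_pos (mul_pos hgj
      (Summit.QuantumFields.Balaban3D.Proofs.CouplingWindow.pFun_pos _ _ _ 𝔠.b₀_pos hgj (gk_le_one S S.gK_le_one j hj)))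
  -- the clamped lift and the family `U ↦ clampCfg box (lift U)`
  set lo := loK L j z with hlo
  set hi := bondHiK L j z κ with hhi
  have hP : (1 : ℤ) ≤ (L : ℤ) ^ j := by exact_mod_cast Nat.one_le_pow _ _ hL1
  have hlohi : ∀ i, lo i ≤ hi i := fun i => by simp only [hlo, hhi, loK, bondHiK]; split_ifs <;> linarith
  let F : GaugeField S.P 0 G → B7Prop1Explicit.Site S.P.d → Fin S.P.d → (Matrix (Fin 𝔊.N) (Fin 𝔊.N) ℂ)ˣ := fun U => clampCfg lo hi (liftCfg 𝔊 U)
  have hFG : ∀ (U : GaugeField S.P 0 G) x κ', F U x κ' ∈ unitaryUnits (Matrix (Fin 𝔊.N) (Fin 𝔊.N) ℂ) :=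
    fun U x κ' => clampCfg_mem (liftCfg_mem_unitaryUnits 𝔊 U) x κ'
  -- (52) for the clamped lift of `U₀`, at every level `i ≤ j`
  have hVU : ∀ x κ', liftCfg 𝔊 U₀ x κ' ∈ U1 (Matrix (Fin 𝔊.N) (Fin 𝔊.N) ℂ) := fun x κ' => unitaryUnits_le_U1 (liftCfg_mem_unitaryUnits 𝔊 U₀ x κ')
  have h52 : ∀ i, i ≤ j → pdev (F U₀) < α₀ * (((L : ℝ) ^ i)⁻¹) ^ 2 := by
    intro i hi'
    have h1 : pdev (F U₀) ≤ pdevOn lo hi (liftCfg 𝔊 U₀) := pdev_clampCfg_le hlohi hVU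
    have h3 : α₀ * (((L : ℝ) ^ j)⁻¹) ^ 2 ≤ α₀ * (((L : ℝ) ^ i)⁻¹) ^ 2 := by
      have hLr : (1 : ℝ) ≤ L := by exact_mod_cast hL1
      have hij : ((L : ℝ) ^ i) ≤ (L : ℝ) ^ j := pow_le_pow_right₀ hLr hi'
      have hLi : (0 : ℝ) < (L : ℝ) ^ i := by positivity
      have hinv : ((L : ℝ) ^ j)⁻¹ ≤ ((L : ℝ) ^ i)⁻¹ := inv_anti₀ hLi hij
      exact mul_le_mul_of_nonneg_left (pow_le_pow_left₀ (by positivity) hinv 2) hαpos.le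
    exact (h1.trans_lt hU₀).trans_le h3
  -- Prop. 2 at every level `i ≤ j`: plaquettes `< α₀ + 2C₀α₀²` and unitarity of `Ū^i(F U₀)`
  have hP2 : ∀ i, i ≤ j → pdev (avgIter L (F U₀) i) < α₀ + 2 * C0 S.P.d * α₀ ^ 2 ∧
      ∀ i' ≤ i, ∀ x κ', avgIter L (F U₀) i' x κ' ∈ unitaryUnits (Matrix (Fin 𝔊.N) (Fin 𝔊.N) ℂ) :=
    fun i hi' => prop2_explicit L hL2 (avgClosed_unitaryUnits S.P.d L) i (F U₀) (hFG U₀) hαpos hα3 hα2 (h52 i hi')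
  -- the `log`-arguments of every level `i ≤ j` are `< 1` everywhere
  have hWcx : ∀ i, i ≤ j → ∀ (q : B7Prop1Explicit.Site S.P.d) (κ' : Fin S.P.d) (r : Fin S.P.d → Fin L),
      ‖((Wcx L (avgIter L (F U₀) i) q κ' (boxVec L r) : (Matrix (Fin 𝔊.N) (Fin 𝔊.N) ℂ)ˣ) : Matrix (Fin 𝔊.N) (Fin 𝔊.N) ℂ) - 1‖ < 1 := by
    intro i hi' q κ' r
    obtain ⟨hpd, hmem⟩ := hP2 i hi'
    have hU1 : ∀ x κ'', avgIter L (F U₀) i x κ'' ∈ U1 (Matrix (Fin 𝔊.N) (Fin 𝔊.N) ℂ) := fun x κ'' => unitaryUnits_le_U1 (hmem i le_rfl x κ'')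
    have hα' : 0 ≤ α₀ + 2 * C0 S.P.d * α₀ ^ 2 := by have := B7Prop2Explicit.C0_pos S.P.d; positivity
    refine (norm_Wcx_sub_one_le L hL1 (avgIter L (F U₀) i) hU1 hα' hwin
      (fun x μ ν _ => (le_pdev hU1 x μ ν).trans hpd.le) q κ' r).trans_lt ?_
    have hd : (0 : ℝ) ≤ S.P.d := Nat.cast_nonneg _
    have hLr1 : (1 : ℝ) ≤ L := by exact_mod_cast hL1
    have hL0 : (1 : ℝ) ≤ (L : ℝ) ^ 2 := by nlinarith
    nlinarith
  -- continuity at `U₀` of `U ↦ Ū^i(F U)` at every bond, by induction on `i ≤ j`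
  have hcont : ∀ i, i ≤ j → ∀ (y : B7Prop1Explicit.Site S.P.d) (μ : Fin S.P.d),
      ContinuousAt (fun U : GaugeField S.P 0 G => ((avgIter L (F U) i y μ : (Matrix (Fin 𝔊.N) (Fin 𝔊.N) ℂ)ˣ) : Matrix (Fin 𝔊.N) (Fin 𝔊.N) ℂ)) U₀ := by
    intro i
    induction i with
    | zero =>
      intro _ y μ
      simp only [avgIter_zero]
      show ContinuousAt (fun U : GaugeField S.P 0 G => ((clampCfg lo hi (liftCfg 𝔊 U) y μ : (Matrix (Fin 𝔊.N) (Fin 𝔊.N) ℂ)ˣ) :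
        Matrix (Fin 𝔊.N) (Fin 𝔊.N) ℂ)) U₀
      unfold clampCfg
      split_ifs
      · simp only [liftCfg, MonoidHom.coe_toHomUnits]
        exact ((continuous_rho 𝔊).comp (continuous_apply _)).continuousAt
      · simp only [Units.val_one]; exact continuousAt_const
    | succ i ih =>
      intro hi' y μ
      exact continuousAt_val_avgIter_succ (F := F) i (ih (by omega)) y μ (fun r => hWcx i (by omega) _ μ r)
  -- locality: `Ū^j(F U)(z, κ) = Ū^j(lift U)(z, κ)` for every `U`
  have hloc : ∀ U : GaugeField S.P 0 G, avgIter L (F U) j z κ = avgIter L (liftCfg 𝔊 U) j z κ :=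
    fun U => avgIter_congr L hL1 j z κ (clampCfg_agree (liftCfg 𝔊 U))
  have := hcont j le_rfl z κ
  simp only [hloc] at this
  exact this

/-- The plaquette holonomy of the lift at a fixed integer plaquette is continuous in the configuration. [folklore] -/
theorem continuous_val_hol_liftCfg (x : B7Prop1Explicit.Site S.P.d) (w : List (B7Prop1Explicit.Letter S.P.d)) :
    letI := rhoTopology 𝔊; Continuous (fun U : GaugeField S.P 0 G => ((hol (liftCfg 𝔊 U) x w : (Matrix (Fin 𝔊.N) (Fin 𝔊.N) ℂ)ˣ) : Matrix (Fin 𝔊.N) (Fin 𝔊.N) ℂ)) := by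
  letI := rhoTopology 𝔊
  refine continuous_iff_continuousAt.mpr fun U₀ => ?_
  refine BalabanUVNodesN08AlphaLiftAvgCont.continuousAt_val_hol (F := fun U : GaugeField S.P 0 G => liftCfg 𝔊 U) (fun y μ => ?_) x w
  simp only [liftCfg, MonoidHom.coe_toHomUnits]
  exact ((continuous_rho 𝔊).comp (continuous_apply _)).continuousAt

/-- **A CLOSED `pdevOn`-BALL**: `{U | pdevOn lo hi (lift U) ≤ c}` is closed for `c ≥ 0` (finitely many plaquettes, each `‖(lift U)(∂p) − 1‖` continuous). [folklore] -/
theorem isClosed_pdevOn_le (lo hi : B7Prop1Explicit.Site S.P.d) {c : ℝ} (hc : 0 ≤ c) :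
    letI := rhoTopology 𝔊; IsClosed {U : GaugeField S.P 0 G | pdevOn lo hi (liftCfg 𝔊 U) ≤ c} := by
  letI := rhoTopology 𝔊
  haveI : NeZero 𝔊.N := ⟨Nat.pos_iff_ne_zero.mp 𝔊.N_pos⟩
  letI : CStarAlgebra (Matrix (Fin 𝔊.N) (Fin 𝔊.N) ℂ) := {}
  have hV : ∀ (U : GaugeField S.P 0 G) x κ', liftCfg 𝔊 U x κ' ∈ U1 (Matrix (Fin 𝔊.N) (Fin 𝔊.N) ℂ) :=
    fun U x κ' => unitaryUnits_le_U1 (liftCfg_mem_unitaryUnits 𝔊 U x κ')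
  have hset : {U : GaugeField S.P 0 G | pdevOn lo hi (liftCfg 𝔊 U) ≤ c} =
      ⋂ p : {p : B7Prop1Explicit.Site S.P.d × Fin S.P.d × Fin S.P.d // B7Prop1Local.PlaqIn lo hi p},
        {U : GaugeField S.P 0 G | ‖((hol (liftCfg 𝔊 U) p.1.1 (plaqWord p.1.2.1 p.1.2.2) : (Matrix (Fin 𝔊.N) (Fin 𝔊.N) ℂ)ˣ) :
          Matrix (Fin 𝔊.N) (Fin 𝔊.N) ℂ) - 1‖ ≤ c} := by
    ext U
    simp only [mem_setOf_eq, mem_iInter]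
    constructor
    · intro h p
      exact (B7Prop1Local.le_pdevOn (hV U) p.2).trans h
    · intro h
      exact Real.iSup_le (fun p => h p) hc
  rw [hset]
  exact isClosed_iInter fun p => isClosed_le ((continuous_val_hol_liftCfg 𝔊 p.1.1 _).sub continuous_const).norm continuous_const

/-- A pointwise bound on the non-degenerate plaquettes INSIDE a box bounds `pdevOn` (`b ≥ 0`; degenerate plaquettes contribute `0`). [folklore] -/
theorem pdevOn_le_of_forall_ne {𝔸 : Type*} [NormedRing 𝔸] [NormOneClass 𝔸] {d : ℕ} {lo hi : B7Prop1Explicit.Site d}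
    {V : B7Prop1Explicit.Site d → Fin d → 𝔸ˣ} {b : ℝ} (hb : 0 ≤ b)
    (h : ∀ (x : B7Prop1Explicit.Site d) (μ ν : Fin d), μ ≠ ν → InBox lo hi x → ‖((hol V x (plaqWord μ ν) : 𝔸ˣ) : 𝔸) - 1‖ ≤ b) :
    pdevOn lo hi V ≤ b := by
  refine Real.iSup_le (fun p => ?_) hb
  obtain ⟨⟨x, μ, ν⟩, hp⟩ := p
  rcases eq_or_ne μ ν with rfl | hμν
  · show ‖((hol V x (plaqWord μ μ) : 𝔸ˣ) : 𝔸) - 1‖ ≤ b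
    rw [B7Prop2Explicit.hol_plaqWord_self, Units.val_one, sub_self, norm_zero]; exact hb
  · exact h x μ ν hμν hp.1

/-- **THE BOND BOXES OF THE FOUR BONDS OF A NON-DEGENERATE COARSE PLAQUETTE LIE IN ITS PLAQUETTE BOX** (`[loK z′, bondHiK z′ κ′] ⊆ [loK z, plaqHiK z μ ν]` for `(z′, κ′)`
one of `(z, μ), (z + e_μ, ν), (z + e_ν, μ), (z, ν)`, `μ ≠ ν`), hence `pdevOn` on each bond box is at most `pdevOn` on the plaquette box. [folklore] -/
theorem pdevOn_bondBox_le_plaqBox (j : ℕ) (z : B7Prop1Explicit.Site S.P.d) {μ ν : Fin S.P.d} (hμν : μ ≠ ν) (U : GaugeField S.P 0 G) :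
    pdevOn (loK L j z) (bondHiK L j z μ) (liftCfg 𝔊 U) ≤ pdevOn (loK L j z) (B7Prop1Local.plaqHiK L j z μ ν) (liftCfg 𝔊 U) ∧
    pdevOn (loK L j (z + e μ)) (bondHiK L j (z + e μ) ν) (liftCfg 𝔊 U) ≤ pdevOn (loK L j z) (B7Prop1Local.plaqHiK L j z μ ν) (liftCfg 𝔊 U) ∧
    pdevOn (loK L j (z + e ν)) (bondHiK L j (z + e ν) μ) (liftCfg 𝔊 U) ≤ pdevOn (loK L j z) (B7Prop1Local.plaqHiK L j z μ ν) (liftCfg 𝔊 U) ∧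
    pdevOn (loK L j z) (bondHiK L j z ν) (liftCfg 𝔊 U) ≤ pdevOn (loK L j z) (B7Prop1Local.plaqHiK L j z μ ν) (liftCfg 𝔊 U) := by
  haveI : NeZero 𝔊.N := ⟨Nat.pos_iff_ne_zero.mp 𝔊.N_pos⟩
  letI : CStarAlgebra (Matrix (Fin 𝔊.N) (Fin 𝔊.N) ℂ) := {}
  have hV : ∀ x κ', liftCfg 𝔊 U x κ' ∈ U1 (Matrix (Fin 𝔊.N) (Fin 𝔊.N) ℂ) := fun x κ' => unitaryUnits_le_U1 (liftCfg_mem_unitaryUnits 𝔊 U x κ')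
  have hLj : (0 : ℤ) ≤ (L : ℤ) ^ j := by positivity
  -- componentwise inclusion of boxes
  have incl : ∀ (z' : B7Prop1Explicit.Site S.P.d) (κ' : Fin S.P.d), (∀ i, loK L j z i ≤ loK L j z' i) →
      (∀ i, bondHiK L j z' κ' i ≤ B7Prop1Local.plaqHiK L j z μ ν i) →
      ∀ x, InBox (loK L j z') (bondHiK L j z' κ') x → InBox (loK L j z) (B7Prop1Local.plaqHiK L j z μ ν) x :=
    fun z' κ' h1 h2 x hx i => ⟨(h1 i).trans (hx i).1, (hx i).2.trans (h2 i)⟩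
  have hνμ : ν ≠ μ := fun h => hμν h.symm
  refine ⟨pdevOn_mono hV (incl z μ (fun i => le_rfl) fun i => ?_), pdevOn_mono hV (incl (z + e μ) ν (fun i => ?_) fun i => ?_),
    pdevOn_mono hV (incl (z + e ν) μ (fun i => ?_) fun i => ?_), pdevOn_mono hV (incl z ν (fun i => le_rfl) fun i => ?_)⟩
  · simp only [bondHiK, B7Prop1Local.plaqHiK]
    by_cases hi : i = μ
    · rw [if_pos hi, if_pos (Or.inl hi)]
    · rw [if_neg hi]; split_ifs <;> linarith
  · simp only [loK, Pi.add_apply, e_apply]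
    split_ifs <;> nlinarith
  · simp only [bondHiK, B7Prop1Local.plaqHiK, Pi.add_apply, e_apply]
    by_cases hiμ : i = μ
    · subst hiμ; rw [if_pos rfl, if_neg hμν, if_pos (Or.inl rfl)]; nlinarith
    · rw [if_neg hiμ]
      by_cases hiν : i = ν
      · rw [if_pos hiν, if_pos (Or.inr hiν)]; nlinarith
      · rw [if_neg hiν, if_neg (not_or.mpr ⟨hiμ, hiν⟩)]; nlinarith
  · simp only [loK, Pi.add_apply, e_apply]
    split_ifs <;> nlinarith
  · simp only [bondHiK, B7Prop1Local.plaqHiK, Pi.add_apply, e_apply]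
    by_cases hiν : i = ν
    · subst hiν; rw [if_pos rfl, if_neg hνμ, if_pos (Or.inr rfl)]; nlinarith
    · rw [if_neg hiν]
      by_cases hiμ : i = μ
      · rw [if_pos hiμ, if_pos (Or.inl hiμ)]; nlinarith
      · rw [if_neg hiμ, if_neg (not_or.mpr ⟨hiμ, hiν⟩)]; nlinarith
  · simp only [bondHiK, B7Prop1Local.plaqHiK]
    by_cases hi : i = ν
    · rw [if_pos hi, if_pos (Or.inr hi)]
    · rw [if_neg hi]; split_ifs <;> linarith

end Summit.QuantumFields.YangMills.Theorems.ReadLocal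

end
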